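import Mathlib
import Summits.Ventures.PercRepro2.HCov
import Summits.Ventures.PercRepro2.RootLeafUHalf
import Summits.Ventures.PercRepro2.RootLeafUMixK
import Summits.Ventures.PercRepro2.RootLeafUMixKA
import Summits.Ventures.PercRepro2.RootLeafUMixMax
import Summits.Ventures.PercRepro2.CrossClusterFunctional

/-!
# (G4-u): THE MIXED-COVARIANCE BOUND WITH `ρ = hb` — part 1: the functional `φ` and the exploration of
`L = C(u)` (`J₀ = P(T′, bK)`, `J ≤ P(T′, oK, bK)`) (blind cell PercRepro2, p4 g14; S3 item (aa); no definitions;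
the theorem `hb_HoK_add_Xb_nonneg` itself is part 2, RootLeafUMixHbThm)

Under `P' = P(· | K avoids {u, c})` (`K = C(a₂)`, `L = C(u)`), the `ρ`-form of (MIX-K) reads
`Cov'(1_{c∈L}·(1_{b∈K} − ρ) − 1_{b∈L}, 1_{o∈K}) ≥ 0`; cleared by `P₀²` it is `0 ≤ ρ·ℋ′ + X_b`.  The ρ = 1 case
is the BHK step of RootLeafUMixKA.  THEOREM (`hb_HoK_add_Xb_nonneg`): it holds for `ρ = hb = P(b ∈ K)`, the
UNCONDITIONAL connection probability of `b` to `a₂` (engine D350 add. 2: 0 violations on 992,702,520 cells).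

Proof (exploration of the cluster `L = C(u)`): write `g(L) = P(b ∈ C(a₂) in G ∖ L)` (the tree's
`delClusterProb`) and `φ(L) = hb` if `c ∉ L`, `g(L)` if `c ∈ L` — an ANTITONE functional of `L`, because `g` is
antitone (`delClusterProb_anti`) and `g ≤ g(∅) = hb`.  Then
`P₀²·(ρ·ℋ′ + X_b)` at `ρ = hb` equals `[P(T′,bK,oK)·P₀ − J] + [J·P₀ − J₀·P_o + hb·ℋ′] + [the b ∈ L slack]` with
`J₀ = E[1_{c∈L}·g(L)·1_Q] = P(T′, bK)` and `J = E[1_{c∈L}·g(L)·1_{o∈K}·1_Q] ≤ P(T′, bK, oK)` (both by the exploration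
of `L`, `expect_cross_avoid_eq`; the inequality is Harris in `G ∖ L`, `delClusterProb_mul_le`), the middle
bracket is `P₀²·Cov'(φ(L), 1_{o∈K}) ≥ 0` by BHK06 Thm 1.4 in functional form (`bhk_cross_functional_avoid`:
an increasing functional of `C(a₂)` against a decreasing functional of `C(u)` under `a₂ ↮ {u, c}`), and the
slack is `bL_mul_P0_le` (BHK 1.4).  Consequence: `T2oK ≥ 0` on the class `(2β·hb − A)·ℋ′ ≤ ℰ·(e0P₀ − d0P_o)`
(`T2oK_nonneg_of_classK_hb`), which contains the class of RootLeafUMixClass (`hb ≤ 1`).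
-/

namespace Summit.Ventures.PercRepro2

open UnionCluster CovForm

namespace RootLeafU

namespace MixK

variable {V : Type*} {E : Type*} [Fintype E] [DecidableEq E] [Fintype V] [DecidableEq V]
  {R : Type*} [Field R] [LinearOrder R] [IsStrictOrderedRing R]

section Phi

variable (p : E → R) (ends : E → Sym2 V) (a₂ c b : V)

omit [Fintype V] [DecidableEq V] [LinearOrder R] [IsStrictOrderedRing R] in
/-- `g(∅) = hb`: with nothing deleted, `P(b ∈ C(a₂) in G ∖ ∅) = P(a₂ ↔ b)`. -/
lemma delClusterProb_empty_eq :
    delClusterProb p ends a₂ {W : Set V | b ∈ W} (∅ : Set V) = prob p (connEvent ends a₂ b) := by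
  unfold delClusterProb
  congr 1
  ext ω
  simp only [Set.mem_setOf_eq, delConfig_empty_eq_self, mem_cluster, mem_connEvent]

omit [Fintype V] [DecidableEq V] in
/-- `g(L) ≤ hb` for every `L`. -/
lemma delClusterProb_le_hb (hp : IsProbVec p) (L : Set V) :
    delClusterProb p ends a₂ {W : Set V | b ∈ W} L ≤ prob p (connEvent ends a₂ b) := by
  rw [← delClusterProb_empty_eq p ends a₂ b]
  exact delClusterProb_anti p hp ends a₂ (fun _ _ h hb => h hb) (Set.empty_subset L)

omit [Fintype V] [DecidableEq V] in
/-- **`φ` is antitone**: `φ(L) = g(L)` if `c ∈ L`, `hb` if `c ∉ L` (written with indicators). -/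
lemma phi_antitone (hp : IsProbVec p) :
    Antitone (fun L : Set V =>
      ({W : Set V | c ∈ W}).indicator (delClusterProb p ends a₂ {W : Set V | b ∈ W}) L +
        ({W : Set V | c ∉ W}).indicator (fun _ => prob p (connEvent ends a₂ b)) L) := by
  intro L L' h
  have hg := delClusterProb_anti p hp ends a₂ (𝓥 := {W : Set V | b ∈ W}) (fun _ _ h hb => h hb) h
  have hle := delClusterProb_le_hb p ends a₂ b hp L'
  simp only
  by_cases hc : c ∈ L
  · have hc' : c ∈ L' := h hc
    rw [Set.indicator_of_mem (show L ∈ {W : Set V | c ∈ W} from hc),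
      Set.indicator_of_mem (show L' ∈ {W : Set V | c ∈ W} from hc'),
      Set.indicator_of_notMem (show L ∉ {W : Set V | c ∉ W} from fun h' => h' hc),
      Set.indicator_of_notMem (show L' ∉ {W : Set V | c ∉ W} from fun h' => h' hc')]
    linarith
  · rw [Set.indicator_of_notMem (show L ∉ {W : Set V | c ∈ W} from hc),
      Set.indicator_of_mem (show L ∈ {W : Set V | c ∉ W} from hc)]
    by_cases hc' : c ∈ L'
    · rw [Set.indicator_of_mem (show L' ∈ {W : Set V | c ∈ W} from hc'),
        Set.indicator_of_notMem (show L' ∉ {W : Set V | c ∉ W} from fun h' => h' hc')]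
      linarith
    · rw [Set.indicator_of_notMem (show L' ∉ {W : Set V | c ∈ W} from hc'),
        Set.indicator_of_mem (show L' ∈ {W : Set V | c ∉ W} from hc')]

omit [Fintype V] [DecidableEq V] in
/-- `φ ≥ 0`. -/
lemma phi_nonneg (hp : IsProbVec p) (L : Set V) :
    0 ≤ ({W : Set V | c ∈ W}).indicator (delClusterProb p ends a₂ {W : Set V | b ∈ W}) L +
        ({W : Set V | c ∉ W}).indicator (fun _ => prob p (connEvent ends a₂ b)) L := by
  refine add_nonneg (Set.indicator_apply_nonneg fun _ => ?_) (Set.indicator_apply_nonneg fun _ => ?_)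
  · exact delClusterProb_nonneg p hp ends a₂ _ L
  · exact prob_nonneg hp _

end Phi

section Tower

variable (p : E → R) (ends : E → Sym2 V) (o a₂ c b u : V)

omit [Fintype E] [DecidableEq E] [Fintype V] [DecidableEq V] [LinearOrder R] [IsStrictOrderedRing R] in
/-- `1_{v ∈ C_s}` as an indicator of the connection event. -/
lemma indicator_mem_cluster_eq (s v : V) (ω : Config E) :
    ({W : Set V | v ∈ W}).indicator (1 : Set V → R) (cluster ends ω s) =
      (connEvent ends s v).indicator 1 ω := by
  by_cases h : Conn ends ω s v
  · rw [Set.indicator_of_mem (show cluster ends ω s ∈ {W : Set V | v ∈ W} from h),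
      Set.indicator_of_mem (show ω ∈ connEvent ends s v from h)]
    rfl
  · rw [Set.indicator_of_notMem (show cluster ends ω s ∉ {W : Set V | v ∈ W} from h),
      Set.indicator_of_notMem (show ω ∉ connEvent ends s v from h)]

omit [Fintype E] [DecidableEq E] [Fintype V] in
/-- On `{u ↔ c}`, `{a₂ ↮ {u, c}}` is `{u ↮ a₂}`. -/
lemma mem_R_iff_of_conn {ω : Config E} (h : Conn ends ω u c) :
    ω ∈ avoidAll ends a₂ {u, c} ↔ ω ∈ avoidAll ends u {a₂} := by
  simp only [mem_avoidAll, Finset.mem_insert, Finset.mem_singleton, forall_eq_or_imp, forall_eq]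
  constructor
  · rintro ⟨h1, _⟩
    exact fun h' => h1 (conn_symm h')
  · intro h1
    refine ⟨fun h' => h1 (conn_symm h'), fun h' => h1 (conn_trans h (conn_symm h'))⟩

omit [Fintype V] [DecidableEq V] [LinearOrder R] [IsStrictOrderedRing R] in
/-- `delExpect` of an indicator functional is `delClusterProb`. -/
lemma delExpect_indicator_eq (t : V) (𝓥 : Set (Set V)) (W : Set V) :
    delExpect p ends (fun t ω => 𝓥.indicator (1 : Set V → R) (cluster ends ω t)) t W =
      delClusterProb p ends t 𝓥 W := by
  rw [delExpect_clusterFn_apply]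
  unfold delClusterProb
  rw [prob_eq_expect_indicator]
  congr 1

omit [Fintype E] [DecidableEq E] [Fintype V] [DecidableEq V] in
/-- `{u ↔ c} ∩ {a₂ ↔ b} ∩ {u ↮ a₂} = T′ ∩ {b ∈ K}`. -/
lemma Tp_bK_set_eq :
    clusterInEvent ends u {W : Set V | c ∈ W} ∩ clusterInEvent ends a₂ {W : Set V | b ∈ W} ∩
        avoidAll ends u {a₂} =
      TEvent ends a₂ u c ∩ connEvent ends a₂ b := by
  rw [ExploreA3.clusterInEvent_mem_eq, ExploreA3.clusterInEvent_mem_eq, avoidAll_singleton_eq]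
  unfold TEvent
  ext ω
  simp only [Set.mem_inter_iff, Set.mem_compl_iff]
  tauto

omit [Fintype E] [DecidableEq E] [Fintype V] [DecidableEq V] in
/-- `{u ↔ c} ∩ {a₂ ↔ b, a₂ ↔ o} ∩ {u ↮ a₂} = T′ ∩ {o ∈ K, b ∈ K}`. -/
lemma Tp_bK_oK_set_eq :
    clusterInEvent ends u {W : Set V | c ∈ W} ∩
        clusterInEvent ends a₂ ({W : Set V | b ∈ W} ∩ {W : Set V | o ∈ W}) ∩
        avoidAll ends u {a₂} =
      TEvent ends a₂ u c ∩ (connEvent ends a₂ o ∩ connEvent ends a₂ b) := by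
  rw [ExploreA3.clusterInEvent_mem_eq, ExploreA3.clusterInEvent_mem_inter_eq, avoidAll_singleton_eq]
  unfold TEvent
  ext ω
  simp only [Set.mem_inter_iff, Set.mem_compl_iff]
  tauto

omit [DecidableEq V] [LinearOrder R] [IsStrictOrderedRing R] in
/-- **`J₀ = P(T′, bK)`**: the exploration of `L = C(u)` — `E[1_{c∈L} · g(L) · 1_{u↮a₂}] = P(T′, bK)`. -/
lemma J0_eq :
    expect p (fun ω => ({W : Set V | c ∈ W}).indicator (1 : Set V → R) (cluster ends ω u) *
        delClusterProb p ends a₂ {W : Set V | b ∈ W} (cluster ends ω u) *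
        (avoidAll ends u {a₂}).indicator 1 ω) =
      prob p (TEvent ends a₂ u c ∩ connEvent ends a₂ b) := by
  have h := prob_clusterIn_inter_avoid_eq_expect p ends u a₂ (X := {a₂}) (by simp)
    {W : Set V | c ∈ W} {W : Set V | b ∈ W}
  rw [Tp_bK_set_eq ends a₂ c b u] at h
  exact h.symm

omit [DecidableEq V] in
/-- **`J ≤ P(T′, oK, bK)`**: `E[1_{c∈L} · g(L) · 1_{o∈K} · 1_{u↮a₂}] ≤ P(T′, oK, bK)` — the exploration of
`L` turns `1_{o∈K}` into `g_o(L)`, and `g(L)·g_o(L) ≤ g_{bo}(L)` is Harris in `G ∖ L`. -/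
lemma J_le (hp : IsProbVec p) :
    expect p (fun ω => ({W : Set V | c ∈ W}).indicator (1 : Set V → R) (cluster ends ω u) *
        delClusterProb p ends a₂ {W : Set V | b ∈ W} (cluster ends ω u) *
        (connEvent ends a₂ o).indicator 1 ω * (avoidAll ends u {a₂}).indicator 1 ω) ≤
      prob p (TEvent ends a₂ u c ∩ (connEvent ends a₂ o ∩ connEvent ends a₂ b)) := by
  classical
  -- the tower identity with `F₁ = 1_{c∈·} · g` and `Ψ = 1_{o∈·}`
  have ht : a₂ ∈ ({a₂} : Finset V) := by simp
  have tower := expect_cross_avoid_eq p ends u a₂ ht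
    (fun W => ({W : Set V | c ∈ W}).indicator (1 : Set V → R) W *
      delClusterProb p ends a₂ {W : Set V | b ∈ W} W)
    (({W : Set V | o ∈ W}).indicator (1 : Set V → R))
  have e1 : (fun ω => ({W : Set V | c ∈ W}).indicator (1 : Set V → R) (cluster ends ω u) *
      delClusterProb p ends a₂ {W : Set V | b ∈ W} (cluster ends ω u) *
      (connEvent ends a₂ o).indicator 1 ω * (avoidAll ends u {a₂}).indicator 1 ω) =
      (fun ω => (({W : Set V | c ∈ W}).indicator (1 : Set V → R) (cluster ends ω u) *
        delClusterProb p ends a₂ {W : Set V | b ∈ W} (cluster ends ω u)) *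
        ({W : Set V | o ∈ W}).indicator (1 : Set V → R) (cluster ends ω a₂) *
        (avoidAll ends u {a₂}).indicator 1 ω) := by
    funext ω
    rw [indicator_mem_cluster_eq ends a₂ o ω]
  rw [e1, tower]
  simp only [delExpect_indicator_eq]
  -- pointwise: `g_b(L) · g_o(L) ≤ g_{bo}(L)`
  have hpt : ∀ ω, ({W : Set V | c ∈ W}).indicator (1 : Set V → R) (cluster ends ω u) *
      delClusterProb p ends a₂ {W : Set V | b ∈ W} (cluster ends ω u) *
      delClusterProb p ends a₂ {W : Set V | o ∈ W} (cluster ends ω u) *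
      (avoidAll ends u {a₂}).indicator 1 ω ≤
      ({W : Set V | c ∈ W}).indicator (1 : Set V → R) (cluster ends ω u) *
      delClusterProb p ends a₂ ({W : Set V | b ∈ W} ∩ {W : Set V | o ∈ W}) (cluster ends ω u) *
      (avoidAll ends u {a₂}).indicator 1 ω := by
    intro ω
    have hH := ExploreA3.delClusterProb_mul_le p hp ends a₂ (𝓤 := {W : Set V | b ∈ W})
      (𝓥 := {W : Set V | o ∈ W}) (fun _ _ h hb => h hb) (fun _ _ h ho => h ho) (cluster ends ω u)
    have h1 : 0 ≤ ({W : Set V | c ∈ W}).indicator (1 : Set V → R) (cluster ends ω u) :=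
      Set.indicator_apply_nonneg fun _ => zero_le_one
    have h2 : 0 ≤ (avoidAll ends u {a₂}).indicator (1 : Config E → R) ω :=
      Set.indicator_apply_nonneg fun _ => zero_le_one
    have := mul_le_mul_of_nonneg_right (mul_le_mul_of_nonneg_left hH h1) h2
    linarith [this]
  have hmono : expect p (fun ω => ({W : Set V | c ∈ W}).indicator (1 : Set V → R) (cluster ends ω u) *
      delClusterProb p ends a₂ {W : Set V | b ∈ W} (cluster ends ω u) *
      delClusterProb p ends a₂ {W : Set V | o ∈ W} (cluster ends ω u) *
      (avoidAll ends u {a₂}).indicator 1 ω) ≤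
      expect p (fun ω => ({W : Set V | c ∈ W}).indicator (1 : Set V → R) (cluster ends ω u) *
      delClusterProb p ends a₂ ({W : Set V | b ∈ W} ∩ {W : Set V | o ∈ W}) (cluster ends ω u) *
      (avoidAll ends u {a₂}).indicator 1 ω) := by
    unfold expect
    exact Finset.sum_le_sum fun ω _ => mul_le_mul_of_nonneg_left (hpt ω) (weight_nonneg hp ω)
  refine hmono.trans (le_of_eq ?_)
  have h := prob_clusterIn_inter_avoid_eq_expect p ends u a₂ ht {W : Set V | c ∈ W}
    ({W : Set V | b ∈ W} ∩ {W : Set V | o ∈ W})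
  rw [Tp_bK_oK_set_eq ends o a₂ c b u] at h
  exact h.symm

end Tower

end MixK

end RootLeafU

end Summit.Ventures.PercRepro2
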